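import Mathlib
import HarnessLib
import Summits.Ventures.LatticeQCDFlow.Scoring.ReversibleKernelTauIntFloor

/-!
# Geyer's initial-sequence inequalities for EVERY reversible sampler on a general state space: the
# paired autocovariances `Γ_m = C(2m) + C(2m+1)` are nonnegative, NONINCREASING and CONVEX in `m`

HONEST FRAMING: exact (Metropolis-corrected) sampling algorithms for lattice gauge theory;
figures of merit are autocorrelation/cost numbers at stated couplings and volumes; no
continuum-physics claim.

Venture `LatticeQCDFlow` (cell pub-lqcd), topic `Scoring`; FANOUT row 8 (`s0-cpn-nemc`, GEN-23).
NEW WORK of the cell, not a published result; no definition is introduced; nothing is cited as a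
fact.  Row 2's abstract reversible-operator file (`Exactness/ReversibleTauIntFloor`: a weight `w > 0`,
an operator `K` that is bounded-measurable-preserving, linear, `L²(w dμ)`-symmetric and contracting)
proved PAIR POSITIVITY `Γ_m := C(2m) + C(2m+1) ≥ 0` (`C(n) = ∫ g (Kⁿ g) w dμ`) — the first of the three
inequalities behind Geyer's initial-sequence estimators of the asymptotic variance
`σ² = −C(0) + 2 Σ_m Γ_m`.  THIS FILE proves the other two with the same elementary means (two-time
form, Cauchy–Schwarz, contraction — no spectral theorem): with `u = Kᵐ g + K^{m+1} g`,
`Γ_m − Γ_{m+1} = ‖u‖²_w − ⟨u, K u⟩_w ≥ 0` (MONOTONICITY), and with `v = Kᵐ g − K^{m+2} g`,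
`(Γ_m − Γ_{m+1}) − (Γ_{m+1} − Γ_{m+2}) = ‖v‖²_w + ⟨v, K v⟩_w ≥ 0` (CONVEXITY; pair positivity of `v`
at lag `0`).  Then the kernel instances: for every `π`-reversible Markov kernel `κ` (Mathlib's
`Kernel.IsReversible`, `π` a probability law) and every bounded measurable observable `g`, the
stationary paired autocovariances `autocov κ π g (2m) + autocov κ π g (2m+1)` form a nonnegative,
nonincreasing, convex sequence — so along a reversible exact sampler's output the truncation rules
"stop at the first negative pair" (initial positive sequence), "enforce monotonicity" and "enforce
convexity" of the paired empirical autocovariances discard only what the true sequence cannot do.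
Printed counterpart NAMED ONLY: Geyer, *Practical Markov chain Monte Carlo*, Statist. Sci. 7 (1992),
Thm 3.1 (finite / general state space via the spectral theorem) — nothing is cited as a fact.

## Content

Abstract (`(X, μ)`, weight `w > 0` integrable, `K` with (bdd), (lin), (symm), (contr) as in
`Exactness/ReversibleTauIntFloor`; `g` bounded measurable; `C(n) = ∫ g (Kⁿ g) w dμ`):
* `op_inner_le_norm_sq` — `∫ u (K u) w ≤ ∫ u² w` (Cauchy–Schwarz + contraction);
* **`op_pairSum_antitone`** — `C(2m+2) + C(2m+3) ≤ C(2m) + C(2m+1)`;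
* **`op_pairSum_convex`** — `(C(2m+2) + C(2m+3)) − (C(2m+4) + C(2m+5)) ≤ (C(2m) + C(2m+1)) − (C(2m+2) + C(2m+3))`.
Kernel level (`κ` Markov, `π`-reversible probability law, `g` bounded measurable):
* **`autocov_pairSum_antitone_of_isReversible`**, **`autocov_pairSum_convex_of_isReversible`**
  (with `autocov_pair_nonneg_of_isReversible` of `Scoring/ReversibleKernelTauIntFloor`: the three
  Geyer inequalities); `autocov_pairSum_le_first_of_isReversible` — `Γ_m ≤ Γ_0 = C(0) + C(1)`.

NOT CLAIMED: anything about the ESTIMATORS built on these rules (their consistency is a statement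
about empirical autocovariances, not typed here); non-reversible kernels; unbounded observables.
-/

noncomputable section

open MeasureTheory ProbabilityTheory Filter Finset

/-! ### Abstract reversible operators: monotonicity and convexity of the paired sums -/

namespace Summit.Ventures.LatticeQCDFlow.Exactness

section Reversible

variable {X : Type*} [MeasurableSpace X] {μ : Measure X} {w : X → ℝ} {K : (X → ℝ) → (X → ℝ)}

/-- bounded × bounded × (positive integrable weight) is integrable. -/
private theorem integrable_mul_mul_w (hw0 : ∀ x, 0 < w x) (hwm : Measurable w) (hwi : Integrable w μ)
    {a b : X → ℝ} (ham : Measurable a) (hbm : Measurable b) {Ba Bb : ℝ} (hab : ∀ x, |a x| ≤ Ba)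
    (hbb : ∀ x, |b x| ≤ Bb) : Integrable (fun x => a x * b x * w x) μ := by
  refine Integrable.mono' (hwi.const_mul (Ba * Bb)) ((ham.mul hbm).mul hwm).aestronglyMeasurable
    (Eventually.of_forall fun x => ?_)
  rw [Real.norm_eq_abs, abs_mul, abs_mul, abs_of_pos (hw0 x)]
  refine mul_le_mul_of_nonneg_right ?_ (hw0 x).le
  exact mul_le_mul (hab x) (hbb x) (abs_nonneg _) ((abs_nonneg _).trans (hab x))

/-- **`∫ u (K u) w ≤ ∫ u² w`** for a contracting operator (Cauchy–Schwarz: `(∫ u (Ku) w)² ≤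
(∫ u² w)(∫ (Ku)² w) ≤ (∫ u² w)²`). -/
theorem op_inner_le_norm_sq (hw0 : ∀ x, 0 < w x) (hwm : Measurable w) (hwi : Integrable w μ)
    (hbdd : ∀ ⦃f : X → ℝ⦄ ⦃B : ℝ⦄, Measurable f → (∀ x, |f x| ≤ B) →
      Measurable (K f) ∧ ∀ x, |K f x| ≤ B)
    (hcontr : ∀ ⦃f : X → ℝ⦄ ⦃B : ℝ⦄, Measurable f → (∀ x, |f x| ≤ B) →
      ∫ x, K f x ^ 2 * w x ∂μ ≤ ∫ x, f x ^ 2 * w x ∂μ)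
    {u : X → ℝ} (hum : Measurable u) {B : ℝ} (hub : ∀ x, |u x| ≤ B) :
    ∫ x, u x * K u x * w x ∂μ ≤ ∫ x, u x ^ 2 * w x ∂μ := by
  obtain ⟨hvm, hvb⟩ := hbdd hum hub
  have hA0 : 0 ≤ ∫ x, u x ^ 2 * w x ∂μ := integral_nonneg fun x => mul_nonneg (sq_nonneg _) (hw0 x).le
  have hCS := sq_integral_mul_mul_le hw0 hwm hwi hum hvm hub hvb
  have hsq : (∫ x, u x * K u x * w x ∂μ) ^ 2 ≤ (∫ x, u x ^ 2 * w x ∂μ) ^ 2 := by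
    calc (∫ x, u x * K u x * w x ∂μ) ^ 2
        ≤ (∫ x, u x ^ 2 * w x ∂μ) * ∫ x, K u x ^ 2 * w x ∂μ := hCS
      _ ≤ (∫ x, u x ^ 2 * w x ∂μ) * ∫ x, u x ^ 2 * w x ∂μ :=
          mul_le_mul_of_nonneg_left (hcontr hum hub) hA0
      _ = (∫ x, u x ^ 2 * w x ∂μ) ^ 2 := by ring
  exact (abs_le_of_sq_le_sq' hsq hA0).2

/-- **MONOTONICITY of the paired sums**: `C(2m+2) + C(2m+3) ≤ C(2m) + C(2m+1)` with
`C(n) = ∫ g (Kⁿ g) w dμ` — `Γ_m − Γ_{m+1} = ‖u‖² − ⟨u, K u⟩ ≥ 0` for `u = Kᵐ g + K^{m+1} g`. -/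
theorem op_pairSum_antitone (hw0 : ∀ x, 0 < w x) (hwm : Measurable w) (hwi : Integrable w μ)
    (hbdd : ∀ ⦃f : X → ℝ⦄ ⦃B : ℝ⦄, Measurable f → (∀ x, |f x| ≤ B) →
      Measurable (K f) ∧ ∀ x, |K f x| ≤ B)
    (hlin : ∀ ⦃f h : X → ℝ⦄ ⦃Bf Bh : ℝ⦄ (c : ℝ), Measurable f → Measurable h →
      (∀ x, |f x| ≤ Bf) → (∀ x, |h x| ≤ Bh) → ∀ x, K (fun s => f s + c * h s) x = K f x + c * K h x)
    (hsymm : ∀ ⦃f h : X → ℝ⦄ ⦃Bf Bh : ℝ⦄, Measurable f → Measurable h → (∀ x, |f x| ≤ Bf) →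
      (∀ x, |h x| ≤ Bh) → ∫ x, K f x * h x * w x ∂μ = ∫ x, f x * K h x * w x ∂μ)
    (hcontr : ∀ ⦃f : X → ℝ⦄ ⦃B : ℝ⦄, Measurable f → (∀ x, |f x| ≤ B) →
      ∫ x, K f x ^ 2 * w x ∂μ ≤ ∫ x, f x ^ 2 * w x ∂μ)
    {g : X → ℝ} (hgm : Measurable g) {B : ℝ} (hgb : ∀ x, |g x| ≤ B) (m : ℕ) :
    (∫ x, g x * (K^[2 * m + 2] g) x * w x ∂μ) + ∫ x, g x * (K^[2 * m + 3] g) x * w x ∂μ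
      ≤ (∫ x, g x * (K^[2 * m] g) x * w x ∂μ) + ∫ x, g x * (K^[2 * m + 1] g) x * w x ∂μ := by
  -- notation: `p = Kᵐ g`, `q = K^{m+1} g`, `u = p + q`
  obtain ⟨hpm, hpb⟩ := op_iterate_bdd hbdd m hgm hgb
  obtain ⟨hqm, hqb⟩ := op_iterate_bdd hbdd (m + 1) hgm hgb
  obtain ⟨hrm, hrb⟩ := op_iterate_bdd hbdd (m + 2) hgm hgb
  set p := K^[m] g with hp
  set q := K^[m + 1] g with hq
  set r := K^[m + 2] g with hr
  have hKp : K p = q := (Function.iterate_succ_apply' K m g).symm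
  have hKq : K q = r := (Function.iterate_succ_apply' K (m + 1) g).symm
  set u : X → ℝ := fun s => p s + 1 * q s with hu
  have hum : Measurable u := hpm.add (hqm.const_mul 1)
  have hub : ∀ x, |u x| ≤ B + B := fun x => by
    rw [hu]; simp only [one_mul]
    exact (abs_add_le _ _).trans (add_le_add (hpb x) (hqb x))
  have hKu : ∀ x, K u x = q x + r x := fun x => by
    rw [hu, hlin 1 hpm hqm hpb hqb x, hKp, hKq, one_mul]
  -- the four two-time values
  have t1 : ∫ x, p x * p x * w x ∂μ = ∫ x, g x * (K^[2 * m] g) x * w x ∂μ := by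
    rw [hp, op_two_time hbdd hsymm hgm hgb m m, two_mul]
  have t2 : ∫ x, p x * q x * w x ∂μ = ∫ x, g x * (K^[2 * m + 1] g) x * w x ∂μ := by
    rw [hp, hq, op_two_time hbdd hsymm hgm hgb m (m + 1)]; ring_nf
  have t3 : ∫ x, q x * q x * w x ∂μ = ∫ x, g x * (K^[2 * m + 2] g) x * w x ∂μ := by
    rw [hq, op_two_time hbdd hsymm hgm hgb (m + 1) (m + 1)]; ring_nf
  have t4 : ∫ x, p x * r x * w x ∂μ = ∫ x, g x * (K^[2 * m + 2] g) x * w x ∂μ := by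
    rw [hp, hr, op_two_time hbdd hsymm hgm hgb m (m + 2)]; ring_nf
  have t5 : ∫ x, q x * r x * w x ∂μ = ∫ x, g x * (K^[2 * m + 3] g) x * w x ∂μ := by
    rw [hq, hr, op_two_time hbdd hsymm hgm hgb (m + 1) (m + 2)]; ring_nf
  -- integrability of the basic products
  have ipp := integrable_mul_mul_w hw0 hwm hwi hpm hpm hpb hpb
  have ipq := integrable_mul_mul_w hw0 hwm hwi hpm hqm hpb hqb
  have iqq := integrable_mul_mul_w hw0 hwm hwi hqm hqm hqb hqb
  have ipr := integrable_mul_mul_w hw0 hwm hwi hpm hrm hpb hrb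
  have iqr := integrable_mul_mul_w hw0 hwm hwi hqm hrm hqb hrb
  -- `∫ u² w = C(2m) + 2C(2m+1) + C(2m+2)`
  have hnorm : ∫ x, u x ^ 2 * w x ∂μ
      = (∫ x, g x * (K^[2 * m] g) x * w x ∂μ) + 2 * (∫ x, g x * (K^[2 * m + 1] g) x * w x ∂μ)
        + ∫ x, g x * (K^[2 * m + 2] g) x * w x ∂μ := by
    have e : (fun x => u x ^ 2 * w x)
        = fun x => (p x * p x * w x + 2 * (p x * q x * w x)) + q x * q x * w x := by
      funext x; rw [hu]; ring
    have hI2 : Integrable (fun x => 2 * (p x * q x * w x)) μ := ipq.const_mul 2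
    have hI1 : Integrable (fun x => p x * p x * w x + 2 * (p x * q x * w x)) μ := ipp.add hI2
    rw [e, integral_add hI1 iqq, integral_add ipp hI2, integral_const_mul, t1, t2, t3]
  -- `∫ u (K u) w = C(2m+1) + 2C(2m+2) + C(2m+3)`
  have hinner : ∫ x, u x * K u x * w x ∂μ
      = (∫ x, g x * (K^[2 * m + 1] g) x * w x ∂μ) + 2 * (∫ x, g x * (K^[2 * m + 2] g) x * w x ∂μ)
        + ∫ x, g x * (K^[2 * m + 3] g) x * w x ∂μ := by
    have e : (fun x => u x * K u x * w x)
        = fun x => (p x * q x * w x + (p x * r x * w x + q x * q x * w x)) + q x * r x * w x := by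
      funext x; rw [hKu x, hu]; ring
    have hI3 : Integrable (fun x => p x * r x * w x + q x * q x * w x) μ := ipr.add iqq
    have hI4 : Integrable (fun x => p x * q x * w x + (p x * r x * w x + q x * q x * w x)) μ :=
      ipq.add hI3
    rw [e, integral_add hI4 iqr, integral_add ipq hI3, integral_add ipr iqq, t2, t3, t4, t5]
    ring
  have hle := op_inner_le_norm_sq hw0 hwm hwi hbdd hcontr hum hub
  rw [hnorm, hinner] at hle
  linarith

/-- **CONVEXITY of the paired sums**: the decrements `Γ_m − Γ_{m+1}` are nonincreasing, i.e.
`(C(2m+2) + C(2m+3)) − (C(2m+4) + C(2m+5)) ≤ (C(2m) + C(2m+1)) − (C(2m+2) + C(2m+3))` — pair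
positivity at lag `0` for `v = Kᵐ g − K^{m+2} g`. -/
theorem op_pairSum_convex (hw0 : ∀ x, 0 < w x) (hwm : Measurable w) (hwi : Integrable w μ)
    (hbdd : ∀ ⦃f : X → ℝ⦄ ⦃B : ℝ⦄, Measurable f → (∀ x, |f x| ≤ B) →
      Measurable (K f) ∧ ∀ x, |K f x| ≤ B)
    (hlin : ∀ ⦃f h : X → ℝ⦄ ⦃Bf Bh : ℝ⦄ (c : ℝ), Measurable f → Measurable h →
      (∀ x, |f x| ≤ Bf) → (∀ x, |h x| ≤ Bh) → ∀ x, K (fun s => f s + c * h s) x = K f x + c * K h x)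
    (hsymm : ∀ ⦃f h : X → ℝ⦄ ⦃Bf Bh : ℝ⦄, Measurable f → Measurable h → (∀ x, |f x| ≤ Bf) →
      (∀ x, |h x| ≤ Bh) → ∫ x, K f x * h x * w x ∂μ = ∫ x, f x * K h x * w x ∂μ)
    (hcontr : ∀ ⦃f : X → ℝ⦄ ⦃B : ℝ⦄, Measurable f → (∀ x, |f x| ≤ B) →
      ∫ x, K f x ^ 2 * w x ∂μ ≤ ∫ x, f x ^ 2 * w x ∂μ)
    {g : X → ℝ} (hgm : Measurable g) {B : ℝ} (hgb : ∀ x, |g x| ≤ B) (m : ℕ) :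
    ((∫ x, g x * (K^[2 * m + 2] g) x * w x ∂μ) + ∫ x, g x * (K^[2 * m + 3] g) x * w x ∂μ)
        - ((∫ x, g x * (K^[2 * m + 4] g) x * w x ∂μ) + ∫ x, g x * (K^[2 * m + 5] g) x * w x ∂μ)
      ≤ ((∫ x, g x * (K^[2 * m] g) x * w x ∂μ) + ∫ x, g x * (K^[2 * m + 1] g) x * w x ∂μ)
        - ((∫ x, g x * (K^[2 * m + 2] g) x * w x ∂μ) + ∫ x, g x * (K^[2 * m + 3] g) x * w x ∂μ) := by
  -- notation: `p = Kᵐ g`, `q = K^{m+1} g`, `r = K^{m+2} g`, `s₃ = K^{m+3} g`, `v = p − r`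
  obtain ⟨hpm, hpb⟩ := op_iterate_bdd hbdd m hgm hgb
  obtain ⟨hqm, hqb⟩ := op_iterate_bdd hbdd (m + 1) hgm hgb
  obtain ⟨hrm, hrb⟩ := op_iterate_bdd hbdd (m + 2) hgm hgb
  obtain ⟨hsm, hsb⟩ := op_iterate_bdd hbdd (m + 3) hgm hgb
  set p := K^[m] g with hp
  set q := K^[m + 1] g with hq
  set r := K^[m + 2] g with hr
  set s₃ := K^[m + 3] g with hs
  have hKp : K p = q := (Function.iterate_succ_apply' K m g).symm
  have hKr : K r = s₃ := (Function.iterate_succ_apply' K (m + 2) g).symm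
  set v : X → ℝ := fun t => p t + (-1) * r t with hv
  have hvm : Measurable v := hpm.add (hrm.const_mul (-1))
  have hvb : ∀ x, |v x| ≤ B + B := fun x => by
    rw [hv]
    calc |p x + (-1) * r x| ≤ |p x| + |(-1) * r x| := abs_add_le _ _
      _ ≤ B + B := by rw [neg_one_mul, abs_neg]; exact add_le_add (hpb x) (hrb x)
  have hKv : ∀ x, K v x = q x - s₃ x := fun x => by
    rw [hv, hlin (-1) hpm hrm hpb hrb x, hKp, hKr]; ring
  -- pair positivity of `v` at lag 0: `0 ≤ ∫ v v w + ∫ v (K v) w`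
  have hpair := op_pair_nonneg hw0 hwm hwi hbdd hsymm hcontr hvm hvb 0
  simp only [Nat.mul_zero, Function.iterate_zero, id_eq, Nat.zero_add, Function.iterate_one] at hpair
  -- two-time values
  have t1 : ∫ x, p x * p x * w x ∂μ = ∫ x, g x * (K^[2 * m] g) x * w x ∂μ := by
    rw [hp, op_two_time hbdd hsymm hgm hgb m m, two_mul]
  have t2 : ∫ x, p x * q x * w x ∂μ = ∫ x, g x * (K^[2 * m + 1] g) x * w x ∂μ := by
    rw [hp, hq, op_two_time hbdd hsymm hgm hgb m (m + 1)]; ring_nf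
  have t4 : ∫ x, p x * r x * w x ∂μ = ∫ x, g x * (K^[2 * m + 2] g) x * w x ∂μ := by
    rw [hp, hr, op_two_time hbdd hsymm hgm hgb m (m + 2)]; ring_nf
  have t6 : ∫ x, p x * s₃ x * w x ∂μ = ∫ x, g x * (K^[2 * m + 3] g) x * w x ∂μ := by
    rw [hp, hs, op_two_time hbdd hsymm hgm hgb m (m + 3)]; ring_nf
  have t7 : ∫ x, r x * q x * w x ∂μ = ∫ x, g x * (K^[2 * m + 3] g) x * w x ∂μ := by
    rw [hr, hq, op_two_time hbdd hsymm hgm hgb (m + 2) (m + 1)]; ring_nf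
  have t8 : ∫ x, r x * r x * w x ∂μ = ∫ x, g x * (K^[2 * m + 4] g) x * w x ∂μ := by
    rw [hr, op_two_time hbdd hsymm hgm hgb (m + 2) (m + 2)]; ring_nf
  have t9 : ∫ x, r x * s₃ x * w x ∂μ = ∫ x, g x * (K^[2 * m + 5] g) x * w x ∂μ := by
    rw [hr, hs, op_two_time hbdd hsymm hgm hgb (m + 2) (m + 3)]; ring_nf
  have ipp := integrable_mul_mul_w hw0 hwm hwi hpm hpm hpb hpb
  have ipq := integrable_mul_mul_w hw0 hwm hwi hpm hqm hpb hqb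
  have ipr := integrable_mul_mul_w hw0 hwm hwi hpm hrm hpb hrb
  have ips := integrable_mul_mul_w hw0 hwm hwi hpm hsm hpb hsb
  have irq := integrable_mul_mul_w hw0 hwm hwi hrm hqm hrb hqb
  have irr := integrable_mul_mul_w hw0 hwm hwi hrm hrm hrb hrb
  have irs := integrable_mul_mul_w hw0 hwm hwi hrm hsm hrb hsb
  -- `∫ v v w = C(2m) − 2C(2m+2) + C(2m+4)`
  have hvv : ∫ x, v x * v x * w x ∂μ
      = (∫ x, g x * (K^[2 * m] g) x * w x ∂μ) - 2 * (∫ x, g x * (K^[2 * m + 2] g) x * w x ∂μ)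
        + ∫ x, g x * (K^[2 * m + 4] g) x * w x ∂μ := by
    have e : (fun x => v x * v x * w x)
        = fun x => (p x * p x * w x - 2 * (p x * r x * w x)) + r x * r x * w x := by
      funext x; rw [hv]; ring
    have hI2 : Integrable (fun x => 2 * (p x * r x * w x)) μ := ipr.const_mul 2
    have hI1 : Integrable (fun x => p x * p x * w x - 2 * (p x * r x * w x)) μ := ipp.sub hI2
    rw [e, integral_add hI1 irr, integral_sub ipp hI2, integral_const_mul, t1, t4, t8]
  -- `∫ v (K v) w = C(2m+1) − 2C(2m+3) + C(2m+5)`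
  have hvKv : ∫ x, v x * K v x * w x ∂μ
      = (∫ x, g x * (K^[2 * m + 1] g) x * w x ∂μ) - 2 * (∫ x, g x * (K^[2 * m + 3] g) x * w x ∂μ)
        + ∫ x, g x * (K^[2 * m + 5] g) x * w x ∂μ := by
    have e : (fun x => v x * K v x * w x)
        = fun x => ((p x * q x * w x - p x * s₃ x * w x) - r x * q x * w x) + r x * s₃ x * w x := by
      funext x; rw [hKv x, hv]; ring
    have hI5 : Integrable (fun x => p x * q x * w x - p x * s₃ x * w x) μ := ipq.sub ips
    have hI6 : Integrable (fun x => (p x * q x * w x - p x * s₃ x * w x) - r x * q x * w x) μ :=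
      hI5.sub irq
    rw [e, integral_add hI6 irs, integral_sub hI5 irq, integral_sub ipq ips, t2, t6, t7, t9]
    ring
  rw [hvv, hvKv] at hpair
  linarith

end Reversible

end Summit.Ventures.LatticeQCDFlow.Exactness

/-! ### Kernel level: every `π`-reversible Markov kernel -/

namespace Summit.Ventures.LatticeQCDFlow.Scoring

open Summit.Ventures.LatticeQCDFlow.Exactness

variable {Ω : Type*} [MeasurableSpace Ω]

section Kernel

variable {κ : Kernel Ω Ω} [IsMarkovKernel κ] {π : Measure Ω} [IsProbabilityMeasure π]

/-- **MONOTONE PAIRS for every reversible kernel**: `κ` Markov and `π`-reversible (`π` a probability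
law), `g` bounded measurable, `C(t) = autocov κ π g t`: `C(2m+2) + C(2m+3) ≤ C(2m) + C(2m+1)`. -/
theorem autocov_pairSum_antitone_of_isReversible (hrev : Kernel.IsReversible κ π) {g : Ω → ℝ}
    (hg : Measurable g) {B : ℝ} (hB : ∀ x, |g x| ≤ B) (m : ℕ) :
    autocov κ π g (2 * m + 2) + autocov κ π g (2 * m + 3)
      ≤ autocov κ π g (2 * m) + autocov κ π g (2 * m + 1) := by
  have h := op_pairSum_antitone (μ := π) (w := fun _ : Ω => (1 : ℝ)) (K := kop κ)
    (fun _ => one_pos) measurable_const (integrable_const _) kop_opBdd kop_opLin (kop_opSymm hrev)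
    (kop_opContr hrev.invariant) hg hB m
  simpa only [integral_mul_iterate_kop_mul_one] using h

/-- **CONVEX PAIRS for every reversible kernel**: the decrements of `Γ_m = C(2m) + C(2m+1)` are
nonincreasing: `Γ_{m+1} − Γ_{m+2} ≤ Γ_m − Γ_{m+1}`. -/
theorem autocov_pairSum_convex_of_isReversible (hrev : Kernel.IsReversible κ π) {g : Ω → ℝ}
    (hg : Measurable g) {B : ℝ} (hB : ∀ x, |g x| ≤ B) (m : ℕ) :
    (autocov κ π g (2 * m + 2) + autocov κ π g (2 * m + 3))
        - (autocov κ π g (2 * m + 4) + autocov κ π g (2 * m + 5))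
      ≤ (autocov κ π g (2 * m) + autocov κ π g (2 * m + 1))
        - (autocov κ π g (2 * m + 2) + autocov κ π g (2 * m + 3)) := by
  have h := op_pairSum_convex (μ := π) (w := fun _ : Ω => (1 : ℝ)) (K := kop κ)
    (fun _ => one_pos) measurable_const (integrable_const _) kop_opBdd kop_opLin (kop_opSymm hrev)
    (kop_opContr hrev.invariant) hg hB m
  simpa only [integral_mul_iterate_kop_mul_one] using h

/-- **Every paired sum is at most the first**: `C(2m) + C(2m+1) ≤ C(0) + C(1)` (monotonicity
iterated) — with `C(2m) + C(2m+1) ≥ 0` (`autocov_pair_nonneg_of_isReversible`) the pairs of a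
reversible sampler live in `[0, C(0) + C(1)]`. -/
theorem autocov_pairSum_le_first_of_isReversible (hrev : Kernel.IsReversible κ π) {g : Ω → ℝ}
    (hg : Measurable g) {B : ℝ} (hB : ∀ x, |g x| ≤ B) :
    ∀ m : ℕ, autocov κ π g (2 * m) + autocov κ π g (2 * m + 1) ≤ autocov κ π g 0 + autocov κ π g 1
  | 0 => by simp
  | m + 1 => by
    have h1 := autocov_pairSum_antitone_of_isReversible hrev hg hB m
    have h2 := autocov_pairSum_le_first_of_isReversible hrev hg hB m
    have e1 : 2 * (m + 1) = 2 * m + 2 := by ring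
    have e2 : 2 * m + 2 + 1 = 2 * m + 3 := by ring
    rw [e1, e2]
    exact h1.trans h2

end Kernel

end Summit.Ventures.LatticeQCDFlow.Scoring


end
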